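import Mathlib
import Summits.Ventures.HodgeRepro2.T5HodgeStar

/-!
# T5KahlerModel — the Kähler form, the (1,1)-covectors and primitivity of (2,0) in the coframe model

Tier-5 support for sub-step N1 (Hodge-theoretic side; memo route/T5-N1-hodge-p6.md §H1 and §H3):
H1 quotes Voisin's conventions «ω_m = (i/2) Σ_i dz_i ∧ dz̄_i» and «Lemma 3.8 The volume form
associated to a Hermitian metric h on M is equal to ω^n/n!» [p0063 ll. 27–35], and H3 begins with
«on a compact Kähler surface every class of H^{2,0}(S) is primitive (Lα = ω ∧ α ∈ H^{3,1}(S) = 0)».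
In the six-coefficient model of `T5HodgeStar` (coframe `dx₁, dy₁, dx₂, dy₂`, coefficients on
`dx₁∧dy₁, dx₁∧dx₂, dx₁∧dy₂, dy₁∧dx₂, dy₁∧dy₂, dx₂∧dy₂`, `wedge γ δ` = the coefficient of `Vol` in
`γ ∧ δ`) these sentences are finite computations:

* `dz1dzbar1`, `dz1dzbar2`, `dz2dzbar1`, `dz2dzbar2`: the four (1,1)-covectors `dz_i ∧ dz̄_j`,
  `oneOne c`: a general (1,1)-covector, `kahler`: the Kähler covector
  `ω = (i/2)(dz₁∧dz̄₁ + dz₂∧dz̄₂) = dx₁∧dy₁ + dx₂∧dy₂` (`kahler_eq`);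
* `wedge_kahler_kahler`: `ω ∧ ω = 2 Vol`, i.e. `Vol = ω²/2!` — Lemma 3.8 for `n = 2`; `herm_kahler`:
  `‖ω‖² = 2 = n`; `hodgeStar_kahler`: `*ω = ω` (ω is self-dual in real dimension 4);
* `wedge_kahler_twoZero` / `wedge_oneOne_twoZero`: `ω ∧ α = 0`, indeed `η ∧ α = 0` for every
  (1,1)-covector `η` and (2,0)-covector `α` — the pointwise form of «`Λ^{3,1} = 0` on a surface»,
  so every (2,0)-form is primitive; `wedge_twoZero_twoZero`: `α ∧ α' = 0` (`Λ^{4,0} = 0`);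
* `wedge_oneOne_conjC_twoZero`: also `η ∧ ᾱ = 0` (`Λ^{1,3} = 0`).

Blind lane (cell pub-hodge-repro2): `import Mathlib` + own `T5HodgeStar`, 0 sorry, standard axioms.
-/

namespace Summit.Ventures.HodgeRepro2.T5KahlerModel

open Summit.Ventures.HodgeRepro2.T5HodgeStar Complex

/-- `dz₁ ∧ dz̄₁ = (dx₁ + i dy₁) ∧ (dx₁ − i dy₁) = −2i dx₁∧dy₁`. -/
def dz1dzbar1 : TwoCovector := ![-2 * I, 0, 0, 0, 0, 0]

/-- `dz₂ ∧ dz̄₂ = −2i dx₂∧dy₂`. -/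
def dz2dzbar2 : TwoCovector := ![0, 0, 0, 0, 0, -2 * I]

/-- `dz₁ ∧ dz̄₂ = (dx₁ + i dy₁) ∧ (dx₂ − i dy₂) = dx₁∧dx₂ − i dx₁∧dy₂ + i dy₁∧dx₂ + dy₁∧dy₂`. -/
def dz1dzbar2 : TwoCovector := ![0, 1, -I, I, 1, 0]

/-- `dz₂ ∧ dz̄₁ = (dx₂ + i dy₂) ∧ (dx₁ − i dy₁) = −dx₁∧dx₂ − i dx₁∧dy₂ + i dy₁∧dx₂ − dy₁∧dy₂`. -/
def dz2dzbar1 : TwoCovector := ![0, -1, -I, I, -1, 0]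

/-- A general (1,1)-covector `Σ_{i,j} c_{ij} dz_i ∧ dz̄_j`. -/
def oneOne (c : Fin 2 → Fin 2 → ℂ) : TwoCovector :=
  c 0 0 • dz1dzbar1 + c 0 1 • dz1dzbar2 + c 1 0 • dz2dzbar1 + c 1 1 • dz2dzbar2

/-- The Kähler covector of the hermitian metric in the orthonormal coframe,
`ω = dx₁∧dy₁ + dx₂∧dy₂`. -/
def kahler : TwoCovector := ![1, 0, 0, 0, 0, 1]

/-- Voisin's formula `ω = (i/2) Σ_i dz_i ∧ dz̄_i` [p0063 l. 35] in the model. -/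
theorem kahler_eq : kahler = (I / 2) • (dz1dzbar1 + dz2dzbar2) := by
  ext i
  fin_cases i <;> simp [kahler, dz1dzbar1, dz2dzbar2] <;> ring_nf <;> simp [I_sq]

/-- The Kähler covector is a (1,1)-covector: `ω = oneOne c` with `c = (i/2)·δ_{ij}`. -/
theorem kahler_eq_oneOne : kahler = oneOne fun i j => if i = j then I / 2 else 0 := by
  rw [kahler_eq]
  simp only [oneOne, Fin.isValue, ↓reduceIte, zero_ne_one, one_ne_zero, zero_smul, add_zero,
    smul_add]

/-- `ω ∧ ω = 2 Vol`: Lemma 3.8 [p0063 l. 27] for a surface, `Vol = ω²/2!`. -/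
theorem wedge_kahler_kahler : wedge kahler kahler = 2 := by
  simp [wedge, kahler]
  norm_num

/-- `‖ω‖² = 2 (= n)` for the pointwise metric with the six wedges orthonormal. -/
theorem herm_kahler : herm kahler kahler = 2 := by
  simp [herm, kahler, Fin.sum_univ_six]
  norm_num

/-- The Kähler covector is real. -/
theorem conjC_kahler : conjC kahler = kahler := by
  ext i
  fin_cases i <;> simp [conjC, kahler]

/-- `*ω = ω`: the Kähler form of a surface is self-dual. -/
theorem hodgeStar_kahler : hodgeStar kahler = kahler := by
  ext i
  fin_cases i <;> simp [hodgeStar, kahler]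

/-- `ω ∧ α = 0` for every (2,0)-covector `α = a dz₁∧dz₂`: `Lα ∈ Λ^{3,1} = 0` — every (2,0)-form on
a surface is primitive (memo H3, first sentence). -/
theorem wedge_kahler_twoZero (a : ℂ) : wedge kahler (twoZero a) = 0 := by
  simp [wedge, kahler, twoZero, dz12]

/-- `η ∧ α = 0` for every (1,1)-covector `η` and (2,0)-covector `α` (`Λ^{3,1} = 0`). -/
theorem wedge_oneOne_twoZero (c : Fin 2 → Fin 2 → ℂ) (a : ℂ) : wedge (oneOne c) (twoZero a) = 0 := by
  simp [wedge, oneOne, twoZero, dz12, dz1dzbar1, dz1dzbar2, dz2dzbar1, dz2dzbar2]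
  ring_nf

/-- `η ∧ ᾱ = 0` for every (1,1)-covector `η` and (2,0)-covector `α` (`Λ^{1,3} = 0`). -/
theorem wedge_oneOne_conjC_twoZero (c : Fin 2 → Fin 2 → ℂ) (a : ℂ) :
    wedge (oneOne c) (conjC (twoZero a)) = 0 := by
  simp [wedge, oneOne, conjC, twoZero, dz12, dz1dzbar1, dz1dzbar2, dz2dzbar1, dz2dzbar2]
  ring_nf

/-- `α ∧ α' = 0` for two (2,0)-covectors (`Λ^{4,0} = 0`). -/
theorem wedge_twoZero_twoZero (a b : ℂ) : wedge (twoZero a) (twoZero b) = 0 := by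
  simp [wedge, twoZero, dz12]
  ring_nf
  rw [I_sq]
  ring

/-- `wedge` is symmetric on 2-covectors (`γ ∧ δ = δ ∧ γ` for even degree). -/
theorem wedge_comm (γ δ : TwoCovector) : wedge γ δ = wedge δ γ := by
  simp only [wedge]
  ring

/-- Hence also `α ∧ ω = 0` for a (2,0)-covector. -/
theorem wedge_twoZero_kahler (a : ℂ) : wedge (twoZero a) kahler = 0 := by
  rw [wedge_comm, wedge_kahler_twoZero]

end Summit.Ventures.HodgeRepro2.T5KahlerModel
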